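import Mathlib
import HarnessLib
import Summits.Ventures.LatticeQCDFlow.Exactness.TransformedHMC
import Summits.Ventures.LatticeQCDFlow.Exactness.CircleGroupJacobian

/-!
# FT-HMC with the engine's U(1) masked layer is exact, end to end: the layer as a measurable equivalence of `ι → U(1)` and `thmc_hmc_exact` instantiated

HONEST FRAMING: exact (Metropolis-corrected) sampling algorithms for lattice gauge theory;
figures of merit are autocorrelation/cost numbers at stated couplings and volumes; no
continuum-physics claim.

Venture `LatticeQCDFlow` (cell pub-lqcd), topic `Exactness`; FANOUT row 14 (`eng-flowhmc`, engine
`latflow.fthmc`: `dynamics.Dynamics` = HMC for `H̃(V, π) = ½|π|² + S(F V) − log det F_*(V)`,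
reported through `F`).  NEW WORK of the cell joining row 7's `TransformedHMC.thmc_hmc_exact` (FT-HMC
is exact for ANY measurable bijection `F` with `HasJacobian` and any volume-preserving involutive
integrator), row 31's `Theory2.coupleEquiv` (a coupling layer of single-link measurable
EQUIVALENCES with jointly measurable inverses is a measurable equivalence of `ι → G`) and row 14's
certificates (`U1MaskedLayerCircleMap`: Banach inversion of the single-link map;
`CircleGroupJacobian`: `HasJacobian` on `ι → Circle` for `Measure.pi haarProbability`).  Nothing is
cited as a fact.

## Content

* `u1LayerInv_fixedPoint_add_int_mul_two_pi` — the inverse lift `Ψ = Φ⁻¹` (the Banach fixed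
  point of `T_u θ = u − Σ_j c_j sin(α_j − θ)`) has degree one;
  **`measurable_u1LayerInv_fixedPoint`** — `(u, y) ↦ Ψ_{c(y),α(y)}(u)` is jointly measurable for
  measurable coefficient / angle maps (it is the pointwise limit of the engine's fixed-point
  iterates, each an explicit measurable expression: `measurable_of_tendsto_metrizable`).
* **`exists_measurableEquiv_u1Layer`** — for `Σ_j |c_j| < 1` the engine's single-link map IS a
  measurable equivalence `ψ : U(1) ≃ᵐ U(1)` with `ψ (e^{iθ}) = e^{iΦ θ}` and
  `ψ⁻¹ (e^{iu}) = e^{iΨ u}` (built through `Complex.arg`, no choice involved in the values);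
  **`exists_coupleEquiv_u1Layer`** — for environments measurable in the frozen links, a family
  `ψ a y : U(1) ≃ᵐ U(1)` with these formulas whose forward AND inverse maps are jointly measurable
  in (link, frozen links) — the hypotheses of `Theory2.coupleEquiv`.
* **`thmc_hmc_exact_u1CoupleEquiv`** — THE ENGINE'S ALGORITHM ON THE U(1) RUNG, TYPED: on
  `(ι → U(1)) × P` (links with product Haar probability, any momenta space with s-finite `volP`,
  any measurable action `S` and kinetic term `T`), for the masked layer `F = coupleEquiv ψ …` with
  contraction indicator `< 1` and its Jacobian `J = coupleJac = ∏_active (1 − C)`, and ANY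
  measurable `vol ⊗ volP`-preserving involution `Φ` of phase space (leapfrog / OMF + momentum
  flip at any step size), the FT-HMC kernel for `H̃ = S ∘ F − log J + T` reported through `F`
  leaves `e^{−(S + T)} · (Haar^ι ⊗ volP)` invariant.  A member with several layers is the
  composition (`MeasurableEquiv.trans`, `HasJacobian.comp`); with `S = β S_W ∘ u1Rep` this is the
  Wilson target of the U(1) rung.

NOT here: the momentum refresh and ergodicity (as in `TransformedHMC`); SU(N).
-/

noncomputable section

namespace Summit.Ventures.LatticeQCDFlow.Exactness

open Real Set Function MeasureTheory Filter Summit.Ventures.LatticeQCDFlow.Theory2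
open ProbabilityTheory ProbabilityTheory.Kernel
open Literature.MathematicalPhysics.QuantumFieldTheory (haarProbability)
open scoped NNReal ENNReal Topology

/-! ## The inverse lift: degree one and joint measurability -/

section InverseLift

variable {n : ℕ}

/-- The inverse lift has degree one: `Ψ(u + 2πk) = Ψ(u) + 2πk`. -/
theorem u1LayerInv_fixedPoint_add_int_mul_two_pi (c α : Fin n → ℝ) (hκ : ∑ j, |c j| < 1)
    (u : ℝ) (k : ℤ) :
    ContractingWith.fixedPoint _ (contractingWith_u1LayerInv c α hκ (u + k * (2 * π))) =
      ContractingWith.fixedPoint _ (contractingWith_u1LayerInv c α hκ u) + k * (2 * π) := by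
  symm
  apply eq_fixedPoint_of_u1Layer_eq c α hκ
  rw [u1Layer_add_int_mul_two_pi, u1Layer_fixedPoint c α hκ u]

/-- **The inverse lift is jointly measurable** in the target `u` and in measurable environment
parameters `y` (coefficients `c y`, angles `α y`): it is the pointwise limit of the engine's
fixed-point iterates started at `u`. -/
theorem measurable_u1LayerInv_fixedPoint {Y : Type*} [MeasurableSpace Y] (cy αy : Y → Fin n → ℝ)
    (hc : ∀ j, Measurable fun y => cy y j) (hα : ∀ j, Measurable fun y => αy y j)
    (hκ : ∀ y, ∑ j, |cy y j| < 1) :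
    Measurable fun w : ℝ × Y =>
      ContractingWith.fixedPoint _ (contractingWith_u1LayerInv (cy w.2) (αy w.2) (hκ w.2) w.1) := by
  have hiter : ∀ N : ℕ, Measurable fun w : ℝ × Y =>
      (fun θ : ℝ => w.1 - ∑ j, cy w.2 j * sin (αy w.2 j - θ))^[N] w.1 := by
    intro N
    induction N with
    | zero => simpa only [Function.iterate_zero, id_eq] using measurable_fst
    | succ N ih =>
      simp only [Function.iterate_succ_apply']
      exact measurable_fst.sub (Finset.measurable_sum _ fun j _ =>
        ((hc j).comp measurable_snd).mul (measurable_sin.comp (((hα j).comp measurable_snd).sub ih)))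
  refine measurable_of_tendsto_metrizable hiter ?_
  rw [tendsto_pi_nhds]
  intro w
  exact tendsto_iterate_u1LayerInv (cy w.2) (αy w.2) (hκ w.2) w.1 w.1

/-- The inverse lift for fixed coefficients is measurable in `u`. -/
theorem measurable_u1LayerInv_fixedPoint' (c α : Fin n → ℝ) (hκ : ∑ j, |c j| < 1) :
    Measurable fun u : ℝ => ContractingWith.fixedPoint _ (contractingWith_u1LayerInv c α hκ u) :=
  (measurable_u1LayerInv_fixedPoint (Y := Unit) (fun _ => c) (fun _ => α) (fun _ => measurable_const)
    (fun _ => measurable_const) (fun _ => hκ)).comp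
      (measurable_id.prodMk (measurable_const (a := ())))

end InverseLift

/-! ## The single-link map as a measurable equivalence of `U(1)` -/

section Equiv

variable {n : ℕ}

/-- **The engine's single-link map is a measurable equivalence of `U(1)`** (`Σ_j |c_j| < 1`):
`ψ (e^{iθ}) = e^{i(θ + Σ_j c_j sin(α_j − θ))}` and `ψ⁻¹ (e^{iu}) = e^{iΨ(u)}` with `Ψ` the Banach
fixed point of the engine's inversion map (both maps are periodic lifts through `ℝ/2πℤ ≃ᵐ U(1)`;
their values do not involve any choice). -/
theorem exists_measurableEquiv_u1Layer (c α : Fin n → ℝ) (hκ : ∑ j, |c j| < 1) :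
    ∃ ψ : Circle ≃ᵐ Circle,
      (∀ θ : ℝ, ψ (Circle.exp θ) = Circle.exp (θ + ∑ j, c j * sin (α j - θ))) ∧
      (∀ u : ℝ, ψ.symm (Circle.exp u) =
        Circle.exp (ContractingWith.fixedPoint _ (contractingWith_u1LayerInv c α hκ u))) := by
  -- the forward / backward lifts `θ ↦ e^{iΦ θ}`, `u ↦ e^{iΨ u}` are `2π`-periodic
  have hF₀ : Function.Periodic (fun θ : ℝ => Circle.exp (θ + ∑ j, c j * sin (α j - θ))) (2 * π) := by
    intro θ
    simp only
    rw [u1Layer_add_two_pi, Circle.exp_add, Circle.exp_two_pi, mul_one]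
  have hG₀ : Function.Periodic (fun u : ℝ =>
      Circle.exp (ContractingWith.fixedPoint _ (contractingWith_u1LayerInv c α hκ u))) (2 * π) := by
    intro u
    simp only
    have h := u1LayerInv_fixedPoint_add_int_mul_two_pi c α hκ u 1
    simp only [Int.cast_one, one_mul] at h
    rw [h, Circle.exp_add, Circle.exp_two_pi, mul_one]
  -- pulling back along `ℝ/2πℤ ≃ᵐ U(1)`
  have hEsymm : ∀ θ : ℝ, (Homeomorph.toMeasurableEquiv AddCircle.homeomorphCircle' :
        AddCircle (2 * π) ≃ᵐ Circle).symm (Circle.exp θ) = (θ : AddCircle (2 * π)) := fun θ => by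
    rw [← coe_circleEquiv_apply_coe, MeasurableEquiv.symm_apply_apply]
  have keyF : ∀ θ : ℝ, hF₀.lift ((Homeomorph.toMeasurableEquiv AddCircle.homeomorphCircle' :
        AddCircle (2 * π) ≃ᵐ Circle).symm (Circle.exp θ)) =
      Circle.exp (θ + ∑ j, c j * sin (α j - θ)) := fun θ => by
    rw [hEsymm, Function.Periodic.lift_coe]
  have keyG : ∀ u : ℝ, hG₀.lift ((Homeomorph.toMeasurableEquiv AddCircle.homeomorphCircle' :
        AddCircle (2 * π) ≃ᵐ Circle).symm (Circle.exp u)) =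
      Circle.exp (ContractingWith.fixedPoint _ (contractingWith_u1LayerInv c α hκ u)) := fun u => by
    rw [hEsymm, Function.Periodic.lift_coe]
  have hmf : Measurable fun g : Circle => hF₀.lift ((Homeomorph.toMeasurableEquiv AddCircle.homeomorphCircle' :
        AddCircle (2 * π) ≃ᵐ Circle).symm g) :=
    Circle.measurable_of_measurable_comp_exp (by
      simp_rw [keyF]; exact Circle.exp.continuous.measurable.comp (continuous_u1Layer c α).measurable)
  have hmb : Measurable fun g : Circle => hG₀.lift ((Homeomorph.toMeasurableEquiv AddCircle.homeomorphCircle' :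
        AddCircle (2 * π) ≃ᵐ Circle).symm g) :=
    Circle.measurable_of_measurable_comp_exp (by
      simp_rw [keyG]
      exact Circle.exp.continuous.measurable.comp (measurable_u1LayerInv_fixedPoint' c α hκ))
  refine ⟨{ toFun := fun g => hF₀.lift ((Homeomorph.toMeasurableEquiv AddCircle.homeomorphCircle' :
        AddCircle (2 * π) ≃ᵐ Circle).symm g)
            invFun := fun g => hG₀.lift ((Homeomorph.toMeasurableEquiv AddCircle.homeomorphCircle' :
        AddCircle (2 * π) ≃ᵐ Circle).symm g)
            left_inv := fun g => ?_
            right_inv := fun g => ?_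
            measurable_toFun := hmf
            measurable_invFun := hmb }, fun θ => keyF θ, fun u => keyG u⟩
  · -- `ψ⁻¹ (ψ g) = g`
    obtain ⟨θ, rfl⟩ := Circle.exp_surjective g
    simp only
    rw [keyF, keyG, ← eq_fixedPoint_of_u1Layer_eq c α hκ rfl]
  · -- `ψ (ψ⁻¹ g) = g`
    obtain ⟨u, rfl⟩ := Circle.exp_surjective g
    simp only
    rw [keyG, keyF, u1Layer_fixedPoint c α hκ u]

/-- **The family version** (environments measurable in the frozen links): single-link measurable
equivalences with the engine's formulas whose forward and inverse maps are jointly measurable in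
(link, frozen links) — the hypotheses of row 31's `Theory2.coupleEquiv`. -/
theorem exists_coupleEquiv_u1Layer {ι : Type*} {p : ι → Prop}
    (c α : {i // p i} → ({i // ¬p i} → Circle) → Fin n → ℝ)
    (hc : ∀ a k, Measurable fun y => c a y k) (hα : ∀ a k, Measurable fun y => α a y k)
    (hκ : ∀ a y, ∑ k, |c a y k| < 1) :
    ∃ ψ : {i // p i} → ({i // ¬p i} → Circle) → Circle ≃ᵐ Circle,
      (∀ a y (θ : ℝ), ψ a y (Circle.exp θ) = Circle.exp (θ + ∑ k, c a y k * sin (α a y k - θ))) ∧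
      (∀ a, Measurable fun q : Circle × ({i // ¬p i} → Circle) => ψ a q.2 q.1) ∧
      (∀ a, Measurable fun q : Circle × ({i // ¬p i} → Circle) => (ψ a q.2).symm q.1) := by
  choose ψ hψ hψs using fun a y => exists_measurableEquiv_u1Layer (c a y) (α a y) (hκ a y)
  refine ⟨ψ, hψ, fun a => ?_, fun a => ?_⟩
  · refine Circle.measurable_of_measurable_comp_exp_prod ?_
    simp_rw [hψ]
    exact Circle.exp.continuous.measurable.comp (measurable_fst.add (Finset.measurable_sum _
      fun k _ => ((hc a k).comp measurable_snd).mul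
        (measurable_sin.comp (((hα a k).comp measurable_snd).sub measurable_fst))))
  · refine Circle.measurable_of_measurable_comp_exp_prod ?_
    simp_rw [hψs]
    exact Circle.exp.continuous.measurable.comp
      (measurable_u1LayerInv_fixedPoint (c a) (α a) (hc a) (hα a) (hκ a))

end Equiv

/-! ## FT-HMC with the U(1) masked layer: the end-to-end statement -/

section THMC

variable {ι : Type*} [Fintype ι] {p : ι → Prop} [DecidablePred p] {n : ℕ}
  {P : Type*} [MeasurableSpace P] {volP : Measure P} [SFinite volP]

/-- **FT-HMC through the engine's U(1) masked layer is exact.**  Links `ι → U(1)` with the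
product Haar probability measure, momenta in any `(P, volP)`; the layer `F = coupleEquiv ψ …` with
the engine's single-link maps (contraction indicator `< 1`, environment measurable in the frozen
links) and Jacobian `J = coupleJac p jac = ∏_active (1 − C)`; ANY measurable action `S`, kinetic
term `T` and measurable `Haar^ι ⊗ volP`-preserving involution `Φ` of phase space.  Then the HMC
kernel for `H̃(V, π) = (S (F V) − log J(V)) + T(π)` reported through `F × id` leaves
`e^{−(S + T)} · Haar^ι ⊗ volP` invariant. -/
theorem thmc_hmc_exact_u1CoupleEquiv
    (c α : {i // p i} → ({i // ¬p i} → Circle) → Fin n → ℝ)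
    (hc : ∀ a k, Measurable fun y => c a y k) (hα : ∀ a k, Measurable fun y => α a y k)
    (hκ : ∀ a y, ∑ k, |c a y k| < 1)
    (ψ : {i // p i} → ({i // ¬p i} → Circle) → Circle ≃ᵐ Circle)
    (hψ : ∀ a y (θ : ℝ), ψ a y (Circle.exp θ) = Circle.exp (θ + ∑ k, c a y k * sin (α a y k - θ)))
    (hψm : ∀ a, Measurable fun q : Circle × ({i // ¬p i} → Circle) => ψ a q.2 q.1)
    (hψsm : ∀ a, Measurable fun q : Circle × ({i // ¬p i} → Circle) => (ψ a q.2).symm q.1)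
    {jac : {i // p i} → ({i // ¬p i} → Circle) → Circle → ℝ}
    (hjac : ∀ a y (θ : ℝ), jac a y (Circle.exp θ) = 1 - ∑ k, c a y k * cos (α a y k - θ))
    {S : (ι → Circle) → ℝ} (hS : Measurable S) {T : P → ℝ} (hT : Measurable T)
    {Φ : (ι → Circle) × P → (ι → Circle) × P} {hΦ : Measurable Φ} (hinv : Function.Involutive Φ)
    (hvol : MeasurePreserving Φ
      ((Measure.pi fun _ : ι => haarProbability Circle).prod volP)
      ((Measure.pi fun _ : ι => haarProbability Circle).prod volP)) :
    Invariant
      (conjKernel (involMH Φ hΦ fun z : (ι → Circle) × P =>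
          (S (coupleEquiv ψ hψm hψsm z.1) - Real.log (coupleJac p jac z.1)) + T z.2)
        ((coupleEquiv ψ hψm hψsm).prodCongr (MeasurableEquiv.refl P)))
      (((Measure.pi fun _ : ι => haarProbability Circle).prod volP).withDensity
        fun z => ENNReal.ofReal (Real.exp (-(S z.1 + T z.2)))) := by
  -- per-link factor: positive at every point of `U(1)`, jointly measurable
  have hj0 : ∀ a y g, 0 < jac a y g := fun a y g => by
    obtain ⟨θ, rfl⟩ := Circle.exp_surjective g
    rw [hjac]
    exact u1LayerJac_pos (c a y) (α a y) (hκ a y) θ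
  have hjm : ∀ a, Measurable fun q : Circle × ({i // ¬p i} → Circle) => jac a q.2 q.1 := fun a => by
    refine Circle.measurable_of_measurable_comp_exp_prod ?_
    simp_rw [hjac]
    exact measurable_const.sub (Finset.measurable_sum _ fun k _ =>
      ((hc a k).comp measurable_snd).mul
        (measurable_cos.comp (((hα a k).comp measurable_snd).sub measurable_fst)))
  have hF : HasJacobian (Measure.pi fun _ : ι => haarProbability Circle)
      (coupleEquiv ψ hψm hψsm) fun U => ENNReal.ofReal (coupleJac p jac U) :=
    hasJacobian_coupleFun_circleGroup_u1Layer c α hc hα hκ (ψ := fun a y g => ψ a y g) hψ hjac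
  exact thmc_hmc_exact (F := coupleEquiv ψ hψm hψsm) (J := coupleJac p jac)
    (fun U => coupleJac_pos hj0 U) (measurable_coupleJac hjm) hF hS hT hinv hvol

end THMC

end Summit.Ventures.LatticeQCDFlow.Exactness
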